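import Mathlib.RingTheory.RegularLocalRing.Defs
import Mathlib.RingTheory.Nakayama
import Mathlib.Algebra.CharP.Frobenius
import Mathlib.Algebra.CharP.Lemmas
import HarnessLib

/-!
# An ideal inside `𝔪²` does not change the embedding dimension; the Frobenius-power quotient
# `R ⧸ 𝔪^{[q]}` has the full cotangent space

`Literature/RingTheory/RegularLocalRing/EmbeddingDimensionQuotient.lean`, namespace
`Literature.RingTheory.RegularLocalRing`. Everything is PROVED; no definitions, Mathlib only.

For a Noetherian local ring `(R, 𝔪)` and an ideal `I` with `R ⧸ I` local:

* `spanFinrank_maximalIdeal_quotient_le` — `μ(𝔪_{R⧸I}) ≤ μ(𝔪_R)` (the embedding dimension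
  `μ(𝔪) = dim 𝔪/𝔪²` does not go up in quotients);
* **`spanFinrank_maximalIdeal_quotient_eq_of_le_sq`** — if `I ⊆ 𝔪²` then `μ(𝔪_{R⧸I}) = μ(𝔪_R)`
  (Nakayama: lifts of generators of `𝔪/I` generate `𝔪` modulo `𝔪²`, hence generate `𝔪`);
  `finrank_cotangentSpace_quotient_eq_of_le_sq` — the same for `dim 𝔪/𝔪²` over the residue fields;
* `map_iterateFrobenius_le_pow` — the **Frobenius power** `I^{[pⁿ]} := I.map (a ↦ a^{pⁿ})`
  (exponential characteristic `p`) lies in `I^{pⁿ}`; hence for `q = pⁿ ≥ 2`,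
  **`spanFinrank_maximalIdeal_quotient_map_iterateFrobenius`: `μ(𝔪_{R ⧸ 𝔪^{[q]}}) = μ(𝔪_R)`**, and
  `= dim R` when `R` is regular (`…_of_isRegularLocalRing`). For the local ring of a smooth group
  scheme at the origin, `Spec(R ⧸ 𝔪^{[q]})` is the kernel of the `q`-Frobenius, and the statement
  reads «the Frobenius kernel has the full Lie algebra».

(The Summits-side files `Ventures/HSemireg/PorteousShapesRegularity` and the `MvPowerSeries` form in
`Literature/AlgebraicGeometry/Deformation/ObstructionSpaceDimensionBound` prove the `I ⊆ 𝔪²`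
statement in special situations; this is the general Literature form.)

## References

* [Matsumura1987] H. Matsumura, *Commutative Ring Theory*, CUP 1986, §14 (embedding dimension,
  «the smallest number of elements needed to generate `𝔪`»), Thm. 2.3 (Nakayama).
* [Kunz1969] E. Kunz, Amer. J. Math. 91 (1969), proof of Thm. 2.1 (the ideal `𝔪^{[p]}`).
-/

set_option autoImplicit false

namespace Literature.RingTheory.RegularLocalRing

universe u

open IsLocalRing Module

/-! ## §1 An ideal inside `𝔪²` does not change the embedding dimension -/

section EmbDim

variable {R : Type u} [CommRing R] [IsLocalRing R]

/-- The maximal ideal of `R ⧸ I` is the image of the maximal ideal of `R`. [folklore] -/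
private theorem maximalIdeal_quotient_eq_map (I : Ideal R) [IsLocalRing (R ⧸ I)] :
    maximalIdeal (R ⧸ I) = (maximalIdeal R).map (Ideal.Quotient.mk I) :=
  (map_maximalIdeal_of_surjective (Ideal.Quotient.mk I) Ideal.Quotient.mk_surjective).symm

/-- The maximal ideal of `R ⧸ I` pulls back to the maximal ideal of `R`. [folklore] -/
private theorem comap_maximalIdeal_quotient (I : Ideal R) [IsLocalRing (R ⧸ I)] :
    (maximalIdeal (R ⧸ I)).comap (Ideal.Quotient.mk I) = maximalIdeal R := by
  have hI : I ≠ ⊤ := by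
    intro h
    have : Subsingleton (R ⧸ I) := Ideal.Quotient.subsingleton_iff.mpr h
    exact false_of_nontrivial_of_subsingleton (R ⧸ I)
  rw [maximalIdeal_quotient_eq_map I, Ideal.comap_map_of_surjective _ Ideal.Quotient.mk_surjective,
    ← RingHom.ker_eq_comap_bot, Ideal.mk_ker, sup_eq_left]
  exact le_maximalIdeal hI

/-- **The embedding dimension does not increase in a quotient**: for a Noetherian local ring `R`
and an ideal `I` with `R ⧸ I` local, `μ(𝔪_{R⧸I}) ≤ μ(𝔪_R)` (images of generators generate).
[cite: Matsumura1987, §14 (embedding dimension)] -/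
theorem spanFinrank_maximalIdeal_quotient_le [IsNoetherianRing R] (I : Ideal R)
    [IsLocalRing (R ⧸ I)] :
    (maximalIdeal (R ⧸ I)).spanFinrank ≤ (maximalIdeal R).spanFinrank := by
  rw [maximalIdeal_quotient_eq_map I]
  exact Ideal.spanFinrank_map_le_of_fg (Ideal.Quotient.mk I) (maximalIdeal R).fg_of_isNoetherianRing

/-- **Nakayama step**: if `I ⊆ 𝔪²` then lifts of generators of `𝔪_{R⧸I} = 𝔪/I` already generate `𝔪`,
so `μ(𝔪_R) ≤ μ(𝔪_{R⧸I})`. [cite: Matsumura1987, §14 and Thm. 2.3] -/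
theorem spanFinrank_maximalIdeal_le_quotient_of_le_sq [IsNoetherianRing R] (I : Ideal R)
    [IsLocalRing (R ⧸ I)] (hI : I ≤ maximalIdeal R ^ 2) :
    (maximalIdeal R).spanFinrank ≤ (maximalIdeal (R ⧸ I)).spanFinrank := by
  classical
  obtain ⟨s, hscard, hsspan⟩ := Submodule.FG.exists_span_finset_card_eq_spanFinrank
    (maximalIdeal (R ⧸ I)).fg_of_isNoetherianRing
  set g : R ⧸ I → R := Function.surjInv (Ideal.Quotient.mk_surjective (I := I)) with hg
  set s' : Finset R := s.image g with hs'
  have himage : (Ideal.Quotient.mk I) '' (s' : Set R) = (s : Set (R ⧸ I)) := by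
    rw [hs', Finset.coe_image, ← Set.image_comp, hg, Function.comp_surjInv, Set.image_id]
  have hmap : (Ideal.span (s' : Set R)).map (Ideal.Quotient.mk I) = maximalIdeal (R ⧸ I) := by
    rw [Ideal.map_span, himage]
    exact hsspan
  have hle : maximalIdeal R ≤ Ideal.span (s' : Set R) ⊔ maximalIdeal R • maximalIdeal R := by
    have h1 : maximalIdeal R ≤ Ideal.span (s' : Set R) ⊔ I := by
      have := comap_maximalIdeal_quotient I
      rw [← hmap, Ideal.comap_map_of_surjective _ Ideal.Quotient.mk_surjective,
        ← RingHom.ker_eq_comap_bot, Ideal.mk_ker] at this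
      exact this.ge
    refine h1.trans (sup_le_sup_left ?_ _)
    rw [Ideal.smul_eq_mul, ← pow_two]
    exact hI
  have hNak : maximalIdeal R ≤ Ideal.span (s' : Set R) :=
    Submodule.le_of_le_smul_of_le_jacobson_bot (maximalIdeal R).fg_of_isNoetherianRing
      (maximalIdeal_le_jacobson ⊥) hle
  have hge : Ideal.span (s' : Set R) ≤ maximalIdeal R := by
    rw [Ideal.span_le]
    intro x hx
    have hx' : Ideal.Quotient.mk I x ∈ maximalIdeal (R ⧸ I) := by
      rw [← hsspan]
      refine Ideal.subset_span ?_
      rw [← himage]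
      exact Set.mem_image_of_mem _ hx
    have := Ideal.mem_comap.mpr hx'
    rwa [comap_maximalIdeal_quotient I] at this
  have heq : maximalIdeal R = Ideal.span (s' : Set R) := le_antisymm hNak hge
  calc (maximalIdeal R).spanFinrank = (Ideal.span (s' : Set R)).spanFinrank := by rw [← heq]
    _ ≤ (s' : Set R).ncard := Submodule.spanFinrank_span_le_ncard_of_finite s'.finite_toSet
    _ = s'.card := Set.ncard_coe_finset s'
    _ ≤ s.card := Finset.card_image_le
    _ = (maximalIdeal (R ⧸ I)).spanFinrank := hscard

/-- **An ideal `I ⊆ 𝔪²` does not change the embedding dimension**: `μ(𝔪_{R⧸I}) = μ(𝔪_R)` for a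
Noetherian local ring `R`. [cite: Matsumura1987, §14 and Thm. 2.3] -/
theorem spanFinrank_maximalIdeal_quotient_eq_of_le_sq [IsNoetherianRing R] (I : Ideal R)
    [IsLocalRing (R ⧸ I)] (hI : I ≤ maximalIdeal R ^ 2) :
    (maximalIdeal (R ⧸ I)).spanFinrank = (maximalIdeal R).spanFinrank :=
  le_antisymm (spanFinrank_maximalIdeal_quotient_le I)
    (spanFinrank_maximalIdeal_le_quotient_of_le_sq I hI)

/-- **Zariski cotangent spaces of `R` and `R ⧸ I` have the same dimension when `I ⊆ 𝔪²`.**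
[cite: Matsumura1987, §14 and Thm. 2.3] -/
theorem finrank_cotangentSpace_quotient_eq_of_le_sq [IsNoetherianRing R] (I : Ideal R)
    [IsLocalRing (R ⧸ I)] (hI : I ≤ maximalIdeal R ^ 2) :
    Module.finrank (ResidueField (R ⧸ I)) (CotangentSpace (R ⧸ I)) =
      Module.finrank (ResidueField R) (CotangentSpace R) := by
  rw [← spanFinrank_maximalIdeal_eq_finrank_cotangentSpace,
    ← spanFinrank_maximalIdeal_eq_finrank_cotangentSpace]
  exact spanFinrank_maximalIdeal_quotient_eq_of_le_sq I hI

omit [IsLocalRing R] in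
/-- **The Frobenius power of an ideal lies in the ordinary power**: `I^{[pⁿ]} := I.map (a ↦ a^{pⁿ})`
satisfies `I^{[pⁿ]} ⊆ I^{pⁿ}` (generators `a^{pⁿ}`, `a ∈ I`). [cite: Kunz1969, Thm. 2.1 (proof)] -/
theorem map_iterateFrobenius_le_pow (p : ℕ) [ExpChar R p] (n : ℕ) (I : Ideal R) :
    I.map (iterateFrobenius R p n) ≤ I ^ p ^ n := by
  refine Ideal.span_le.mpr ?_
  rintro _ ⟨a, ha, rfl⟩
  rw [iterateFrobenius_def]
  exact Ideal.pow_mem_pow ha _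

/-- **`emb dim (R ⧸ 𝔪^{[q]}) = emb dim R`** for `q = pⁿ ≥ 2`: the Frobenius power `𝔪^{[q]}` lies in
`𝔪^q ⊆ 𝔪²`. For the local ring of a smooth group at the origin this says that the Frobenius kernel
`Spec(R ⧸ 𝔪^{[q]})` has the full Zariski tangent space («`Lie(ker F_q) = Lie G`»).
[cite: Matsumura1987, §14 and Thm. 2.3] -/
theorem spanFinrank_maximalIdeal_quotient_map_iterateFrobenius [IsNoetherianRing R] (p : ℕ)
    [ExpChar R p] (n : ℕ) (hq : 2 ≤ p ^ n)
    [IsLocalRing (R ⧸ (maximalIdeal R).map (iterateFrobenius R p n))] :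
    (maximalIdeal (R ⧸ (maximalIdeal R).map (iterateFrobenius R p n))).spanFinrank =
      (maximalIdeal R).spanFinrank :=
  spanFinrank_maximalIdeal_quotient_eq_of_le_sq _
    ((map_iterateFrobenius_le_pow p n _).trans (Ideal.pow_le_pow_right hq))

/-- Cotangent-space form of the previous statement:
`dim 𝔪̄/𝔪̄² = dim 𝔪/𝔪²` for `R̄ = R ⧸ 𝔪^{[pⁿ]}`, `pⁿ ≥ 2`. [cite: Matsumura1987, §14 and Thm. 2.3] -/
theorem finrank_cotangentSpace_quotient_map_iterateFrobenius [IsNoetherianRing R] (p : ℕ)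
    [ExpChar R p] (n : ℕ) (hq : 2 ≤ p ^ n)
    [IsLocalRing (R ⧸ (maximalIdeal R).map (iterateFrobenius R p n))] :
    Module.finrank (ResidueField (R ⧸ (maximalIdeal R).map (iterateFrobenius R p n)))
        (CotangentSpace (R ⧸ (maximalIdeal R).map (iterateFrobenius R p n))) =
      Module.finrank (ResidueField R) (CotangentSpace R) :=
  finrank_cotangentSpace_quotient_eq_of_le_sq _
    ((map_iterateFrobenius_le_pow p n _).trans (Ideal.pow_le_pow_right hq))

end EmbDim

/-- For a REGULAR local ring of dimension `d`: `emb dim (A ⧸ 𝔪^{[pⁿ]}) = d` (`pⁿ ≥ 2`).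
[cite: Matsumura1987, §14 and Thm. 2.3] -/
theorem spanFinrank_maximalIdeal_quotient_map_iterateFrobenius_of_isRegularLocalRing
    {R : Type u} [CommRing R] [IsRegularLocalRing R] (p : ℕ) [ExpChar R p] (n : ℕ) (hq : 2 ≤ p ^ n) {d : ℕ}
    (hd : ringKrullDim R = d) [IsLocalRing (R ⧸ (maximalIdeal R).map (iterateFrobenius R p n))] :
    (maximalIdeal (R ⧸ (maximalIdeal R).map (iterateFrobenius R p n))).spanFinrank = d := by
  rw [spanFinrank_maximalIdeal_quotient_map_iterateFrobenius p n hq]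
  have h := IsRegularLocalRing.spanFinrank_maximalIdeal (R := R)
  rw [hd] at h
  exact_mod_cast h


end Literature.RingTheory.RegularLocalRing
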